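import Summits.Ventures.HodgeRepro2.T5RecordJointTwentyOne
import Summits.Ventures.HodgeRepro2.T5CyclotomicInfinitelyManyPlaces
import Summits.Ventures.HodgeRepro2.T5CyclotomicTwentyOneSatake
import Summits.Ventures.HodgeRepro2.T5PrimeOverPlace
import Summits.Ventures.HodgeRepro2.T5RecordJointPredicate

/-!
# Joint consistency at infinitely many places of `F = ℚ(ζ₂₁)^{⟨σ₁₃⟩}` in EACH inert class mod `21`

Tier-5 support N3 / §G-N4.2 (seat p3, gen 88). File 364 counts the places of `F⁺` above the primes `p ≡ 2 (mod 21)`;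
file 363 (v2) gives the joint statement at every place above every prime of the six inert classes
`r ∈ {2, 5, 8, 11, 17, 20}` (file 290's census: `f(P/p) = table r`, even exactly on these classes). This file does the
count class by class, on file 371's `Joint`:

* `vClassOf r` — the record's `placeAboveCyc F p` indexed by the primes `p ≡ r (mod 21)`; `vClassOf_injective`,
  `liesOver_vClassOf`, `natCast_mem_vClassOf`; `coprime_of_mem_inert` (`p ∤ 21` on the inert classes);
* `exists_map_eq_vClassOf` — `v_p` stays prime in `F` for `r` inert (file 290 through file 367's `primeOverPlace`);
* **`absNorm_vClassOf`** — `N(v_p) = p ^ (table r / 2)`: `p³` on the order-`6` classes `2, 5, 11, 17` and `p` on the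
  order-`2` classes `8, 20` (files 290 / 291);
* **`infinite_setOf_joint_twentyOne_of_mem`** — for each inert class `r`, the set of places `v` of `F⁺` above a prime
  `p ≡ r (mod 21)`, staying prime, with `Joint F (vRat p) v w hmap k`, is INFINITE (file 290's Dirichlet statement).

§8(d): uses an L-value-free non-vanishing device: NO.
-/
open Matrix NumberField NumberField.IsCMField IsDedekindDomain IsDedekindDomain.HeightOneSpectrum Module
  MulAction
open scoped TensorProduct Pointwise
open Summit.Ventures.HodgeRepro2.T5UnitaryGroupForm Summit.Ventures.HodgeRepro2.T5UnitaryHeckeAdjoint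
  Summit.Ventures.HodgeRepro2.T5HeckePermutationModule Summit.Ventures.HodgeRepro2.LevelPositivity
  Summit.Ventures.HodgeRepro2.T5LevelIdempotent Summit.Ventures.HodgeRepro2.T5StarOfInvolution
  Summit.Ventures.HodgeRepro2.T5FinitePlaceCM Summit.Ventures.HodgeRepro2.T5NonSplitPlaceUnitaryGroup
  Summit.Ventures.HodgeRepro2.T5RecordHyperspecial Summit.Ventures.HodgeRepro2.T5GlobalLatticeAlmostAll
  Summit.Ventures.HodgeRepro2.T5HermitianThreeElements Summit.Ventures.HodgeRepro2.T5GaloisCartanThree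
  Summit.Ventures.HodgeRepro2.T5InertDegreeGalois Summit.Ventures.HodgeRepro2.T5InertPlaceCompletion
  Summit.Ventures.HodgeRepro2.T5InertDegreeAdicCompletion Summit.Ventures.HodgeRepro2.T5InertSatakeTransform
  Summit.Ventures.HodgeRepro2.T5InertSatakeTransformCompletion Summit.Ventures.HodgeRepro2.T5InertUnipotentResidue
  Summit.Ventures.HodgeRepro2.T5InertSphericalSubquotient Summit.Ventures.HodgeRepro2.T5RecordSatakeCell
  Summit.Ventures.HodgeRepro2.T5SplitPlaceUnitaryGroup Summit.Ventures.HodgeRepro2.T5FinitePlaceNormIndex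
  Summit.Ventures.HodgeRepro2.T5HermitianLocalIsotropyN3 Summit.Ventures.HodgeRepro2.T5FinitePlaceSplitClassification
  Summit.Ventures.HodgeRepro2.T5InertDegreeCompletion Summit.Ventures.HodgeRepro2.T5InertPlaceCompletionCells
  Summit.Ventures.HodgeRepro2.T5RecordSatake Summit.Ventures.HodgeRepro2.T5CartanCellsDistinct
  Summit.Ventures.HodgeRepro2.T5RecordSatakeInert Summit.Ventures.HodgeRepro2.T5InertGlobalPrime
  Summit.Ventures.HodgeRepro2.T5CMFieldSquareDatum Summit.Ventures.HodgeRepro2.T5RecordSatakeDegree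
  Summit.Ventures.HodgeRepro2.T5RecordSatakeDegreeIntrinsic Summit.Ventures.HodgeRepro2.T5RecordSphericalSpectrum
  Summit.Ventures.HodgeRepro2.T5RecordSphericalSpectrumIntrinsic Summit.Ventures.HodgeRepro2.T5RecordSatakeToy
  Summit.Ventures.HodgeRepro2.T5RecordSphericalSpectrumDatumFree
  Summit.Ventures.HodgeRepro2.T5AdditiveConductor Summit.Ventures.HodgeRepro2.T5UnitaryGroupIsometry
  Summit.Ventures.HodgeRepro2.T5ConductorDualLattice Summit.Ventures.HodgeRepro2.T5ConductorDualLatticeSplit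
  Summit.Ventures.HodgeRepro2.T5SplitHermitianClass Summit.Ventures.HodgeRepro2.T5RecordLatticeModelOutsideDiscriminant
  Summit.Ventures.HodgeRepro2.T5RecordLatticeModelSeven Summit.Ventures.HodgeRepro2.T5RecordJointOutsideDiscriminant
  Summit.Ventures.HodgeRepro2.T5RationalPlace Summit.Ventures.HodgeRepro2.T5DiscriminantUnramified
  Summit.Ventures.HodgeRepro2.T5CyclotomicTwentyOneSextic Summit.Ventures.HodgeRepro2.T5CyclotomicTwentyOneCensus
  Summit.Ventures.HodgeRepro2.T5CyclotomicTwentyOneTable Summit.Ventures.HodgeRepro2.T5CyclotomicSevenHeckeCommutative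
  Summit.Ventures.HodgeRepro2.T5RecordJointTwentyOne Summit.Ventures.HodgeRepro2.T5CyclotomicInfinitelyManyPlaces
  Summit.Ventures.HodgeRepro2.T5CyclotomicSevenSplitPrime Summit.Ventures.HodgeRepro2.T5CyclotomicTwentyOneSatake
  Summit.Ventures.HodgeRepro2.T5PrimeOverPlace
  Summit.Ventures.HodgeRepro2.T5RecordJointPredicate

namespace Summit.Ventures.HodgeRepro2.T5RecordJointTwentyOneClasses

universe uV

/-- The six inert classes mod `21` (file 290). -/
abbrev inertClasses : Finset ℕ := {2, 5, 8, 11, 17, 20}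

/-- A prime `p ≡ r (mod 21)` with `r` inert is prime to `21`. -/
theorem coprime_of_mem_inert (r : ℕ) (hr : r ∈ inertClasses) (p : ℕ) (hpr : p % 21 = r) : p.Coprime 21 := by
  rw [← coprime_mod_iff, hpr]
  fin_cases hr <;> decide

/-- `r % 21 = r` on the inert classes. -/
theorem mod_self_of_mem_inert (r : ℕ) (hr : r ∈ inertClasses) : r % 21 = r := by
  fin_cases hr <;> rfl

/-- **Infinitely many primes in each inert class** (file 290's Dirichlet statement). -/
theorem infinite_setOf_prime_and_mod_eq_of_mem_inert (r : ℕ) (hr : r ∈ inertClasses) :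
    {p : ℕ | p.Prime ∧ p % 21 = r}.Infinite := by
  have h := infinite_setOf_prime_eq_mod r (coprime_of_mem_inert r hr r (mod_self_of_mem_inert r hr))
  rwa [mod_self_of_mem_inert r hr] at h

variable (L : Type*) [Field L] [NumberField L] [IsCyclotomicExtension {21} ℚ L]
variable (k : Type*) [Field k] [CharZero k] [IsAlgClosed k]
variable (r : ℕ)

/-- The chosen place of `F⁺` above each prime `p ≡ r (mod 21)` (the record's `placeAboveCyc` on `F`). -/
noncomputable def vClassOf (p : {p : ℕ // p.Prime ∧ p % 21 = r}) :
    HeightOneSpectrum (𝓞 (maximalRealSubfield (fixedField L))) :=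
  placeAboveCyc (fixedField L) p.1 (hp := ⟨p.2.1⟩)

/-- Distinct primes give distinct places. -/
theorem vClassOf_injective : Function.Injective (vClassOf L r) := fun p q h =>
  Subtype.ext (placeAboveCyc_injective_of_prime (fixedField L) p.2.1 q.2.1 h)

/-- `v_p` lies above `(p)`. -/
theorem liesOver_vClassOf (p : {p : ℕ // p.Prime ∧ p % 21 = r}) :
    (vClassOf L r p).asIdeal.LiesOver (Ideal.span {(p.1 : ℤ)}) :=
  liesOver_placeAboveCyc (fixedField L) p.1 (hp := ⟨p.2.1⟩)

/-- `p ∈ v_p`. -/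
theorem natCast_mem_vClassOf (p : {p : ℕ // p.Prime ∧ p % 21 = r}) :
    (p.1 : 𝓞 (maximalRealSubfield (fixedField L))) ∈ (vClassOf L r p).asIdeal :=
  haveI := liesOver_vClassOf L r p
  natCast_mem_of_liesOver (maximalRealSubfield (fixedField L)) p.1 (vClassOf L r p).asIdeal

/-- **`v_p` stays prime in `F`** on the inert classes (file 290's `exists_map_eq_iff_mod` through the chosen prime
`primeOverPlace F v_p`, file 367). -/
theorem exists_map_eq_vClassOf (hr : r ∈ inertClasses) (p : {p : ℕ // p.Prime ∧ p % 21 = r}) :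
    ∃ w : HeightOneSpectrum (𝓞 (fixedField L)),
      Ideal.map (algebraMap (𝓞 (maximalRealSubfield (fixedField L))) (𝓞 (fixedField L))) (vClassOf L r p).asIdeal =
        w.asIdeal :=
  haveI : Fact p.1.Prime := ⟨p.2.1⟩
  haveI := liesOver_vClassOf L r p
  haveI := primeOverPlace_isPrime (fixedField L) (vClassOf L r p)
  haveI := primeOverPlace_liesOver (fixedField L) (vClassOf L r p)
  haveI := primeOverPlace_liesOver_int (fixedField L) p.1 (vClassOf L r p)
  (exists_map_eq_iff_mod L p.1 (coprime_of_mem_inert r hr p.1 p.2.2) (primeOverPlace (fixedField L) (vClassOf L r p)).1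
    (vClassOf L r p)).mpr (by rw [p.2.2]; exact hr)

/-- **`N(v_p) = p ^ (table r / 2)`** on the inert classes: `f(P/p) = table r` (file 290) is even there and equals
`2 · f(v_p/p)` (file 291). -/
theorem absNorm_vClassOf (hr : r ∈ inertClasses) (p : {p : ℕ // p.Prime ∧ p % 21 = r}) :
    Ideal.absNorm (vClassOf L r p).asIdeal = p.1 ^ (table r / 2) := by
  haveI : Fact p.1.Prime := ⟨p.2.1⟩
  haveI := liesOver_vClassOf L r p
  haveI := primeOverPlace_isPrime (fixedField L) (vClassOf L r p)
  haveI := primeOverPlace_liesOver (fixedField L) (vClassOf L r p)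
  haveI := primeOverPlace_liesOver_int (fixedField L) p.1 (vClassOf L r p)
  have hpm : p.1.Coprime 21 := coprime_of_mem_inert r hr p.1 p.2.2
  have hP : (primeOverPlace (fixedField L) (vClassOf L r p)).1.inertiaDeg ℤ = table r := by
    rw [inertiaDeg_eq_table L p.1 hpm, p.2.2]
  have hEven : Even ((primeOverPlace (fixedField L) (vClassOf L r p)).1.inertiaDeg ℤ) := by
    rw [hP]
    exact (even_table_iff r (Finset.mem_range.mpr (by fin_cases hr <;> decide))
      (coprime_of_mem_inert r hr r (mod_self_of_mem_inert r hr))).mpr hr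
  have h2 := inertiaDeg_under_eq L p.1 hpm (primeOverPlace (fixedField L) (vClassOf L r p)).1 (vClassOf L r p) hEven
  rw [← Ideal.pow_inertiaDeg p.1 (vClassOf L r p).asIdeal]
  congr 1
  omega

/-- **AT INFINITELY MANY PLACES OF `F⁺` IN EACH INERT CLASS THE JOINT STATEMENT HOLDS**: for `r ∈ {2, 5, 8, 11, 17, 20}`,
the set of places `v` above a prime `p ≡ r (mod 21)`, staying prime (`v 𝓞_F = w`), with `Joint F (vRat p) v w hmap k`
(file 356's conclusion: the lattice-model data for `diag(1, 1, −1)` over `vRat p` AND the unramified spectrum of the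
record's pair, Satake parameter `α · N(v)⁻² = α · p^{-table r}`), is infinite. -/
theorem infinite_setOf_joint_twentyOne_of_mem (hr : r ∈ inertClasses) :
    haveI := isCMField_fixedField L
    {v : HeightOneSpectrum (𝓞 (maximalRealSubfield (fixedField L))) |
      ∃ (p : ℕ) (hp : Fact p.Prime) (_hpr : p % 21 = r) (hmem : (p : 𝓞 (maximalRealSubfield (fixedField L))) ∈ v.asIdeal)
        (w : HeightOneSpectrum (𝓞 (fixedField L)))
        (hmap : Ideal.map (algebraMap (𝓞 (maximalRealSubfield (fixedField L))) (𝓞 (fixedField L))) v.asIdeal = w.asIdeal),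
        letI : v.asIdeal.LiesOver (@vRat p hp).asIdeal := @liesOver_vRat_of_mem p hp _ _ _ v hmem
        letI := liesOver_of_map_eq (fixedField L) v w hmap
        Joint.{uV, _, _} (fixedField L) (@vRat p hp) v w hmap k}.Infinite := by
  haveI := isCMField_fixedField L
  haveI : Infinite {p : ℕ // p.Prime ∧ p % 21 = r} := (infinite_setOf_prime_and_mod_eq_of_mem_inert r hr).to_subtype
  refine Set.infinite_of_injective_forall_mem (vClassOf_injective L r) fun p => ?_
  haveI hp : Fact p.1.Prime := ⟨p.2.1⟩
  have hmem := natCast_mem_vClassOf L r p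
  obtain ⟨w, hmap⟩ := exists_map_eq_vClassOf L r hr p
  refine ⟨p.1, hp, p.2.2, hmem, w, hmap, ?_⟩
  with_reducible
    exact @joint_of_staysPrime (fixedField L) _ _ (isCMField_fixedField L) (@vRat p.1 hp) (vClassOf L r p)
      (@liesOver_vRat_of_mem p.1 hp _ _ _ (vClassOf L r p) hmem) w (liesOver_of_map_eq (fixedField L) (vClassOf L r p) w hmap)
      hmap k _ _ _
      (@discr_fixedField_notMem L _ _ _ p.1 hp ((Nat.Prime.coprime_iff_not_dvd p.2.1).mp (coprime_of_mem_inert r hr p.1 p.2.2))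
        (vClassOf L r p) (liesOver_int_of_mem p.1 (vClassOf L r p) hmem))

end Summit.Ventures.HodgeRepro2.T5RecordJointTwentyOneClasses
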